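import Mathlib

/-!
# Energy form of Gaussian domination ⇒ the variational susceptibility inequality (first variation)

Solo-blind programme (AtomisticToContinuum / BoseEinsteinCondensation), paper §12.8, Proposition 12.8(b).
The zero-temperature ENERGY FORM of Gaussian domination (Dyson–Lieb–Simon 1978, Thm 4.2, at `β → ∞`) is an operator
inequality `H − s·D ≥ E₀ − ½ s² c` for every real `s` (here `D = D(h)` for a fixed field direction `h`, `c = |h|²`).
Writing `A = H − E₀ ≥ 0`, with ground state `Ψ` (`AΨ = 0`, `⟨Ψ,Ψ⟩ = 1`) and `⟨Ψ, DΨ⟩ = 0`, inserting the trial vector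
`Ψ + εφ` with `s = ε` and letting `ε → 0` yields, for EVERY `φ`,
`2⟨DΨ, φ⟩ − ⟨φ, Aφ⟩ ≤ c/2`,
which is the variational form of the susceptibility bound `⟨DΨ, A⁻¹ DΨ⟩ ≤ c/2` (see `sup_concave_quadratic_iff` in
`SoloBlindEnergyFormSecondOrder`).  Everything is finite-dimensional and stated for real matrices; the only analysis is the
elementary fact that `ε²a + ε³b + ε⁴d ≥ 0` for all real `ε` forces `a ≥ 0`.
-/

namespace Summit.AtomisticToContinuum.BoseEinsteinCondensation.Theorems

open Matrix

variable {n : Type*} [Fintype n]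

/-- If `ε² a + ε³ b + ε⁴ d ≥ 0` for every real `ε`, then `a ≥ 0` (the `ε → 0` extraction of the leading coefficient). -/
theorem nonneg_of_forall_eps_poly (a b d : ℝ) (h : ∀ ε : ℝ, 0 ≤ ε ^ 2 * a + ε ^ 3 * b + ε ^ 4 * d) : 0 ≤ a := by
  -- symmetrise in `ε` to kill the cubic term
  have key : ∀ ε : ℝ, 0 ≤ ε ^ 2 * (a + ε ^ 2 * d) := by
    intro ε
    have h1 := h ε
    have h2 := h (-ε)
    have e2 : (-ε) ^ 2 * a + (-ε) ^ 3 * b + (-ε) ^ 4 * d = ε ^ 2 * a - ε ^ 3 * b + ε ^ 4 * d := by ring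
    rw [e2] at h2
    have e : (ε ^ 2 * a + ε ^ 3 * b + ε ^ 4 * d) + (ε ^ 2 * a - ε ^ 3 * b + ε ^ 4 * d)
        = 2 * (ε ^ 2 * (a + ε ^ 2 * d)) := by ring
    have hsum : 0 ≤ (ε ^ 2 * a + ε ^ 3 * b + ε ^ 4 * d) + (ε ^ 2 * a - ε ^ 3 * b + ε ^ 4 * d) :=
      add_nonneg h1 h2
    rw [e] at hsum
    linarith
  by_contra hneg
  rw [not_le] at hneg
  by_cases hd : d ≤ 0
  · have h1 := key 1
    have : (1 : ℝ) ^ 2 * (a + 1 ^ 2 * d) = a + d := by ring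
    rw [this] at h1
    linarith
  · rw [not_le] at hd
    set t : ℝ := -a / (2 * d) with ht_def
    have ht : 0 < t := div_pos (by linarith) (by linarith)
    have hval : a + t * d = a / 2 := by
      rw [ht_def]; field_simp; ring
    have h1 := key (Real.sqrt t)
    rw [Real.sq_sqrt ht.le, hval] at h1
    nlinarith [h1, ht, hneg]

/-- **Energy form ⇒ variational susceptibility inequality (first variation at the ground state).**
Let `A` (`= H − E₀`) and `D` be real symmetric matrices, `Ψ` a normalised null vector of `A` with `⟨Ψ, DΨ⟩ = 0`, and
suppose the energy form of Gaussian domination: for all real `s` and all `χ`,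
`⟨χ, Aχ⟩ − s⟨χ, Dχ⟩ + ½ s² c ⟨χ,χ⟩ ≥ 0`.  Then for every `φ`: `2⟨DΨ, φ⟩ − ⟨φ, Aφ⟩ ≤ c/2`. -/
theorem energy_form_implies_variational (A D : Matrix n n ℝ) (hA : Aᵀ = A) (hD : Dᵀ = D) (Ψ : n → ℝ)
    (hAΨ : A *ᵥ Ψ = 0) (hΨ : Ψ ⬝ᵥ Ψ = 1) (hΨD : Ψ ⬝ᵥ (D *ᵥ Ψ) = 0) (c : ℝ)
    (hform : ∀ (s : ℝ) (χ : n → ℝ),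
      0 ≤ χ ⬝ᵥ (A *ᵥ χ) - s * (χ ⬝ᵥ (D *ᵥ χ)) + (1 / 2) * s ^ 2 * c * (χ ⬝ᵥ χ))
    (φ : n → ℝ) : 2 * ((D *ᵥ Ψ) ⬝ᵥ φ) - φ ⬝ᵥ (A *ᵥ φ) ≤ c / 2 := by
  -- scalar bookkeeping
  have sA1 : Ψ ⬝ᵥ (A *ᵥ φ) = 0 := by
    rw [Matrix.dotProduct_mulVec, ← Matrix.mulVec_transpose, hA, hAΨ, zero_dotProduct]
  have sA2 : φ ⬝ᵥ (A *ᵥ Ψ) = 0 := by rw [hAΨ, dotProduct_zero]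
  have sD1 : Ψ ⬝ᵥ (D *ᵥ φ) = (D *ᵥ Ψ) ⬝ᵥ φ := by
    rw [Matrix.dotProduct_mulVec, ← Matrix.mulVec_transpose, hD]
  have sD2 : φ ⬝ᵥ (D *ᵥ Ψ) = (D *ᵥ Ψ) ⬝ᵥ φ := dotProduct_comm _ _
  have sN : φ ⬝ᵥ Ψ = Ψ ⬝ᵥ φ := dotProduct_comm _ _
  -- expansion of the three quadratic forms at `χ = Ψ + ε • φ`
  have eA : ∀ ε : ℝ, (Ψ + ε • φ) ⬝ᵥ (A *ᵥ (Ψ + ε • φ)) = ε ^ 2 * (φ ⬝ᵥ (A *ᵥ φ)) := by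
    intro ε
    simp only [Matrix.mulVec_add, Matrix.mulVec_smul, dotProduct_add, add_dotProduct, dotProduct_smul,
      smul_dotProduct, smul_eq_mul, hAΨ, dotProduct_zero, sA1]
    ring
  have eD : ∀ ε : ℝ, (Ψ + ε • φ) ⬝ᵥ (D *ᵥ (Ψ + ε • φ))
      = 2 * ε * ((D *ᵥ Ψ) ⬝ᵥ φ) + ε ^ 2 * (φ ⬝ᵥ (D *ᵥ φ)) := by
    intro ε
    simp only [Matrix.mulVec_add, Matrix.mulVec_smul, dotProduct_add, add_dotProduct, dotProduct_smul,
      smul_dotProduct, smul_eq_mul, hΨD, sD1, sD2]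
    ring
  have eN : ∀ ε : ℝ, (Ψ + ε • φ) ⬝ᵥ (Ψ + ε • φ) = 1 + 2 * ε * (Ψ ⬝ᵥ φ) + ε ^ 2 * (φ ⬝ᵥ φ) := by
    intro ε
    simp only [dotProduct_add, add_dotProduct, dotProduct_smul, smul_dotProduct, smul_eq_mul, hΨ, sN]
    ring
  -- the energy form along `χ = Ψ + ε φ`, `s = ε`, is a polynomial inequality in `ε`
  have poly : ∀ ε : ℝ, 0 ≤ ε ^ 2 * (φ ⬝ᵥ (A *ᵥ φ) - 2 * ((D *ᵥ Ψ) ⬝ᵥ φ) + c / 2)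
      + ε ^ 3 * (c * (Ψ ⬝ᵥ φ) - φ ⬝ᵥ (D *ᵥ φ)) + ε ^ 4 * (c / 2 * (φ ⬝ᵥ φ)) := by
    intro ε
    have h := hform ε (Ψ + ε • φ)
    rw [eA ε, eD ε, eN ε] at h
    have e : ε ^ 2 * (φ ⬝ᵥ (A *ᵥ φ)) - ε * (2 * ε * ((D *ᵥ Ψ) ⬝ᵥ φ) + ε ^ 2 * (φ ⬝ᵥ (D *ᵥ φ)))
        + 1 / 2 * ε ^ 2 * c * (1 + 2 * ε * (Ψ ⬝ᵥ φ) + ε ^ 2 * (φ ⬝ᵥ φ))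
        = ε ^ 2 * (φ ⬝ᵥ (A *ᵥ φ) - 2 * ((D *ᵥ Ψ) ⬝ᵥ φ) + c / 2)
          + ε ^ 3 * (c * (Ψ ⬝ᵥ φ) - φ ⬝ᵥ (D *ᵥ φ)) + ε ^ 4 * (c / 2 * (φ ⬝ᵥ φ)) := by ring
    rw [e] at h
    exact h
  have := nonneg_of_forall_eps_poly _ _ _ poly
  linarith

end Summit.AtomisticToContinuum.BoseEinsteinCondensation.Theorems
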